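import Summits.CriticalPhenomena.PercolationContinuityZ3.Cruxes.PinholeClosing.SketchIdeator2
import Summits.CriticalPhenomena.PercolationContinuityZ3.Theorems.PinholeClosing.Negative.PinholeClosingResistance
import Literature.Probability.Percolation.SiteConnectionTools

/-!
# Triage scratch (crux-triage r1-1, stmt-CriticalPhenomena-5249): `TransitLemma` is false AS TYPED

The first lemma of card `transit-doubling` quantifies over ALL `ω : BondConfig (Site 3) = Set (Sym2 (Site 3))`,
but `openGraph ω = SimpleGraph.fromEdgeSet ω` lets a non-lattice pair act as an open "jump".  Witness:
`n = 1, l = 2, R = 3, L = 5`, `ω = {s(0, (5,0,0))}`: every translate `z + A(1,2)`, `|z|∞ = 3`, has budget 0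
(no open pair inside `z + box 2` touches `z + box 1`), yet `box 1 → ∂ⁱⁿ box 5` is crossed by the jump.
Repair: add the hypothesis `ω ⊆ (zdGraph 3).edgeSet` (a.s. under `P_p`, `setBernoulli_ae_subset`).
The same repair applies to every deterministic `∀ ω` first lemma of the round-1 cards
(`TilingLemma`, `FlatLandscapeExclusion K`, `AntipodalUnionLemma` if stated over all `ω`).
-/

open Literature.Probability.Percolation Literature.Probability.LatticeModels
open Summit.CriticalPhenomena.PercolationContinuityZ3.Cruxes.PinholeClosing.TransitDoubling
open Summit.CriticalPhenomena.PercolationContinuityZ3.Theorems.PinholeClosing.Negative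

namespace TriageR1K1

/-- The lattice point `(i, 0, 0)`. -/
def pt (i : ℕ) : Site 3 := Pi.single 0 (i : ℤ)

@[simp] theorem pt_apply_zero (i : ℕ) : pt i 0 = i := by simp [pt]

theorem pt_apply_ne {j : Fin 3} (hj : j ≠ 0) (i : ℕ) : pt i j = 0 := by simp [pt, hj]

theorem pt_mem_box {i m : ℕ} (h : i ≤ m) : pt i ∈ box 3 m := by
  rw [mem_box]
  intro j
  by_cases hj : j = 0
  · subst hj; simp only [pt_apply_zero]; omega
  · simp only [pt_apply_ne hj]; omega

theorem le_of_pt_mem_box {i n : ℕ} (h : pt i ∈ box 3 n) : i ≤ n := by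
  rw [mem_box] at h
  have := (h 0).2
  simp only [pt_apply_zero] at this
  exact_mod_cast this

theorem pt_succ_eq (i : ℕ) : pt (i + 1) = pt i + Pi.single 0 1 := by
  simp [pt, Nat.cast_succ, Pi.single_add]

theorem pt_mem_innerBoundary (m : ℕ) : pt m ∈ innerBoundary (zdGraph 3) (box 3 m) := by
  rw [mem_innerBoundary_iff]
  refine ⟨pt_mem_box le_rfl, pt (m + 1), fun h => ?_, ?_⟩
  · have := le_of_pt_mem_box h; omega
  · rw [zdGraph_adj_iff]; exact ⟨0, Or.inl (pt_succ_eq m)⟩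

/-- The jump configuration: a single NON-lattice pair `{(0,0,0), (5,0,0)}` declared open. -/
def jump : BondConfig (Site 3) := {s(pt 0, pt 5)}

theorem pt0_ne_pt5 : pt 0 ≠ pt 5 := by
  intro h
  have := congrArg (fun x : Site 3 => x 0) h
  simp at this

/-- The jump crosses `box 1 → ∂ⁱⁿ box 5` inside `box 5`. -/
theorem cross_jump : Cross 1 5 jump := by
  refine ⟨pt 0, pt_mem_box (by norm_num), pt 5, pt_mem_innerBoundary 5, ?_⟩
  refine ⟨Finset.mem_coe.2 (pt_mem_box (by norm_num)), Finset.mem_coe.2 (pt_mem_box le_rfl), ?_⟩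
  refine SimpleGraph.Adj.reachable ?_
  simp only [SimpleGraph.induce_adj, openGraph_adj]
  exact ⟨by simp [jump], pt0_ne_pt5⟩

/-- Every translate `z + A(1, 2)` with `|z|∞ = 3` has budget `0 ≤ 1` in the jump configuration. -/
theorem budgetAt_jump {z : Site 3} (hz : z ∈ innerBoundary (zdGraph 3) (box 3 3)) :
    jump ∈ BudgetAt z 1 (2 * 1) 1 := by
  show BondConfig.relabel (sym2Equiv (Site.shift z)) jump ∈ Budget 1 (2 * 1) 1
  refine ⟨∅, by simp, ?_⟩
  rintro ⟨a, ha, b, hb, haS, hbS, hr⟩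
  obtain ⟨w⟩ := hr
  cases w with
  | nil => exact absurd ha (notMem_box_of_mem_innerBoundary (by norm_num) hb)
  | cons hadj p =>
    rename_i c
    simp only [SimpleGraph.induce_adj, openGraph_adj, Finset.coe_empty, Set.sdiff_empty] at hadj
    obtain ⟨hmem, -⟩ := hadj
    have hmem' : s((a - z) + z, ((c : Site 3) - z) + z) ∈
        BondConfig.relabel (sym2Equiv (Site.shift z)) jump := by simpa using hmem
    rw [mk_add_mem_relabel_shift_iff] at hmem'
    simp only [jump, Set.mem_singleton_iff, Sym2.eq_iff] at hmem'
    obtain ⟨i, hi⟩ := exists_eq_of_mem_innerBoundary_box hz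
    have hzbox : z ∈ box 3 3 := (mem_innerBoundary_iff.1 hz).1
    rw [mem_box] at ha hzbox
    rcases hmem' with ⟨h1, -⟩ | ⟨h1, -⟩
    · -- a - z = pt 0, i.e. a = z: but z has a coordinate ±3 and a ∈ box 1
      have hai : a i - z i = pt 0 i := by rw [← h1]; rfl
      have hp : pt 0 i = 0 := by
        by_cases hi0 : i = 0
        · subst hi0; simp
        · exact pt_apply_ne hi0 0
      have := ha i
      rcases hi with hi | hi <;> omega
    · -- a - z = pt 5: a 0 = z 0 + 5 ≥ 2, but a ∈ box 1
      have ha0 : a 0 - z 0 = pt 5 0 := by rw [← h1]; rfl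
      simp only [pt_apply_zero, Nat.cast_ofNat] at ha0
      have := ha 0
      have := hzbox 0
      omega

/-- **`TransitLemma` (card transit-doubling, `SketchIdeator2.lean`) is false as typed.** -/
theorem not_transitLemma : ¬ TransitLemma := by
  intro h
  exact h 1 2 3 5 le_rfl (by norm_num) (by norm_num) (by norm_num) jump (fun z hz => budgetAt_jump hz)
    cross_jump

end TriageR1K1
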